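import Summits.Langlands.Langlands.Theorems.MinimalLevelDescentDyadicDefs

/-!
Part 2/4 of the support module of the decomp-langlands lens-4 nodes g6 `LevelOneNormalForm` + g7 `DyadicCompanion` for
route-Langlands-MinimalLevelDescent rev 3 (crux Z = `MinimalLevelDescent.LevelOneCrystallineDescent`, stmt-Langlands-31277):
the 1239-line candidate `nodes/lens-4-g7-DyadicCompanion.module.lean` (rc 0 · 0 sorry) CUT by topic at the gate's request
(census REPLY 2026-08-30T09:08:07Z: theorem files ≤ 400 lines, statement-only file ≤ 1000, docstring on every decl), SAME namespace
`Summit.Langlands.Langlands.Theorems.LevelOneDyadic` in all four parts so that every kernel theorem keeps its name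
(`LevelOneDyadic.item_31277_of_pieces`, `…dyadicLevelOneCompanion_iff_pieces`, `…_of_langlands`).  0 sorry; axioms standard.

# Part 2 — FRAME KERNELS (pure logic over Part 1): `Iff.rfl` bridges to the route decls, the trichotomy of local shapes,
the dissolution K ⟸ F ∧ U, exactness M₀ ⟺ K ∧ Z mod L and D ⟺ W ∧ L ∧ K ∧ Z (`levelPrimeDescent_of_four` = the landed glue
`Theorems.LevelPrimeDescent_of_resplit_proof`, p767155), and the collapse of Z's height frame.
-/

set_option linter.dupNamespace false

namespace Summit.Langlands.Langlands.Theorems.LevelOneDyadic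

open scoped NumberField
open Filter IsDedekindDomain Polynomial
open Literature.NumberTheory.GaloisRepresentations Literature.NumberTheory.Automorphic
open Summit.Langlands.Langlands.Theses

variable {K : Type} [Field K] [NumberField K] {ℓ : ℕ} [Fact ℓ.Prime] {n : ℕ}


/-- W⁺'s inlined text IS the route decl `MinimalLevelDescent.SatakeAvatarExistence` (stmt-Langlands-17415). [bookkeeping] -/
theorem wPlus_iff : WPlus ↔ MinimalLevelDescent.SatakeAvatarExistence := Iff.rfl

/-- Lift_w's inlined text IS the route decl `MinimalLevelDescent.AutomorphyLifting` (stmt-Langlands-24016). [bookkeeping] -/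
theorem liftW_iff : LiftW ↔ MinimalLevelDescent.AutomorphyLifting := Iff.rfl

/-- The route of record's D (stmt-Langlands-27524), read in the vocabulary. -/
theorem levelPrimeDescent_iff : MinimalLevelDescent.LevelPrimeDescent ↔
    (WPlus → LiftW → ∀ (k ℓ : ℕ) [Fact ℓ.Prime], ¬ (k = 0 ∧ ℓ = 2) → IHBelow k ℓ → SerreBelow k ℓ) :=
  Iff.rfl

/-- The route of record's W (stmt-Langlands-28623), read in the vocabulary. -/
theorem weightMove_iff : MinimalLevelDescent.WeightMove ↔
    (WPlus → LiftW → ∀ (k ℓ : ℕ) [Fact ℓ.Prime], ¬ (k = 0 ∧ ℓ = 2) → IHBelow k ℓ → CrysBelow k ℓ → SerreBelow k ℓ) :=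
  Iff.rfl

/-- The route of record's L (stmt-Langlands-28624), read in the vocabulary. -/
theorem levelMove_iff : MinimalLevelDescent.LevelMove ↔
    (WPlus → LiftW → ∀ (k ℓ : ℕ) [Fact ℓ.Prime], ¬ (k = 0 ∧ ℓ = 2) → IHBelow k ℓ → NonMinimalBelow k ℓ) :=
  Iff.rfl


/-- The route of record's former M (stmt-Langlands-28625, retired; local text M₀), read in the vocabulary. -/
theorem minimalCrystallineDescent_iff : MinimalCrystallineDescent₀ ↔
    (WPlus → LiftW → ∀ (k ℓ : ℕ) [Fact ℓ.Prime], ¬ (k = 0 ∧ ℓ = 2) → IHBelow k ℓ → MinimalBelow k ℓ) :=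
  Iff.rfl

/-- K (stmt-Langlands-31276) read in the vocabulary: W⁺ → Lift_w → ∀ (k, ℓ) ≠ (0, 2), IHBelow → RamifiedMinimalBelow. [bookkeeping] -/
theorem residualInertiaDescent_iff : ResidualInertiaDescent ↔
    (WPlus → LiftW → ∀ (k ℓ : ℕ) [Fact ℓ.Prime], ¬ (k = 0 ∧ ℓ = 2) → IHBelow k ℓ → NonMinimalBelow k ℓ →
      RamifiedMinimalBelow k ℓ) :=
  Iff.rfl

/-- Z (stmt-Langlands-31277) read in the vocabulary: W⁺ → Lift_w → ∀ odd ℓ, LevelOneIH ℓ → LevelOneBelow ℓ. [bookkeeping] -/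
theorem levelOneCrystallineDescent_iff : LevelOneCrystallineDescent ↔
    (WPlus → LiftW → ∀ (ℓ : ℕ) [Fact ℓ.Prime], ℓ ≠ 2 → LevelOneIH ℓ → LevelOneBelow ℓ) :=
  Iff.rfl

/-- g5's F read in the vocabulary (record). [bookkeeping] -/
theorem finiteInertiaDescent_iff : FiniteInertiaDescent ↔
    (WPlus → LiftW → ∀ (k ℓ : ℕ) [Fact ℓ.Prime], ¬ (k = 0 ∧ ℓ = 2) → IHBelow k ℓ → KillableBelow k ℓ) :=
  Iff.rfl

/-- g5's U read in the vocabulary (record). [bookkeeping] -/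
theorem monodromicDescent_iff : MonodromicDescent ↔
    (WPlus → LiftW → ∀ (k ℓ : ℕ) [Fact ℓ.Prime], ¬ (k = 0 ∧ ℓ = 2) → IHBelow k ℓ → MonodromicBelow k ℓ) :=
  Iff.rfl

/-! ## The local trichotomy (pure logic) and its cleanliness -/

omit [NumberField K] in
/-- Unramified at w ⟹ finite inertia image at w (the image is {1}). -/
theorem hasFiniteInertiaImageAt_of_isUnramifiedAt (ρ : FramedGaloisRep K (PadicAlgCl ℓ) n)
    (w : HeightOneSpectrum (𝓞 K)) (h : ρ.IsUnramifiedAt w) : HasFiniteInertiaImageAt ρ w := by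
  intro 𝔓 h𝔓
  refine (Set.finite_singleton (1 : GL (Fin n) (PadicAlgCl ℓ))).subset ?_
  rintro _ ⟨σ, hσ, rfl⟩
  exact h 𝔓 h𝔓 σ hσ

omit [NumberField K] in
/-- TRICHOTOMY of ρ's local shape away from ℓ: a killable place, or monodromic, or level one. -/
theorem trichotomy (ρ : FramedGaloisRep K (PadicAlgCl ℓ) n) :
    HasKillablePlace ρ ∨ IsMonodromic ρ ∨ IsUnramifiedAwayFrom ρ := by
  by_cases h1 : HasKillablePlace ρ
  · exact Or.inl h1
  by_cases h2 : ∃ w : HeightOneSpectrum (𝓞 K), ((ℓ : ℕ) : 𝓞 K) ∉ w.asIdeal ∧ ¬ ρ.IsUnramifiedAt w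
  · exact Or.inr (Or.inl ⟨h2, fun w hw hram hfin => h1 ⟨w, hw, hram, hfin⟩⟩)
  · exact Or.inr (Or.inr fun w hw => by by_contra hram; exact h2 ⟨w, hw, hram⟩)

omit [NumberField K] in
/-- The three classes are pairwise disjoint (1/2): monodromic ρ have no killable place. -/
theorem not_hasKillablePlace_of_isMonodromic (ρ : FramedGaloisRep K (PadicAlgCl ℓ) n) (h : IsMonodromic ρ) :
    ¬ HasKillablePlace ρ :=
  fun ⟨w, hw, hram, hfin⟩ => h.2 w hw hram hfin

omit [NumberField K] in
/-- The three classes are pairwise disjoint (2/2): level-one ρ are neither killable nor monodromic. -/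
theorem not_killable_not_monodromic_of_isUnramifiedAwayFrom (ρ : FramedGaloisRep K (PadicAlgCl ℓ) n)
    (h : IsUnramifiedAwayFrom ρ) : ¬ HasKillablePlace ρ ∧ ¬ IsMonodromic ρ :=
  ⟨fun ⟨w, hw, hram, _⟩ => hram (h w hw), fun ⟨⟨w, hw, hram⟩, _⟩ => hram (h w hw)⟩

/-! ## Height bookkeeping on the level-one class (pure logic) -/

omit [NumberField K] in
/-- Level ≤ 0 ⟺ level one. -/
theorem hasLevelAtMost_zero_iff (ρ : FramedGaloisRep K (PadicAlgCl ℓ) n) :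
    HasLevelAtMost ρ 0 ↔ IsUnramifiedAwayFrom ρ := by
  constructor
  · rintro ⟨S, hS, h⟩ w hw
    have hS0 : S = ∅ := Finset.card_eq_zero.mp (Nat.le_zero.mp hS)
    exact h w (by simp [hS0]) hw
  · intro h
    exact ⟨∅, by simp, fun v _ hv => h v hv⟩

omit [NumberField K] in
/-- A level-one ρ has every level. -/
theorem hasLevelAtMost_of_isUnramifiedAwayFrom (ρ : FramedGaloisRep K (PadicAlgCl ℓ) n) (h : IsUnramifiedAwayFrom ρ)
    (k : ℕ) : HasLevelAtMost ρ k :=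
  ⟨∅, by simp, fun v _ hv => h v hv⟩

omit [NumberField K] in
/-- A level-one ρ is (vacuously) lift-minimal. -/
theorem isLiftMinimal_of_isUnramifiedAwayFrom (ρ : FramedGaloisRep K (PadicAlgCl ℓ) n) (h : IsUnramifiedAwayFrom ρ) :
    IsLiftMinimal ρ :=
  fun w hw hram => absurd (h w hw) hram

/-- Serre_w at height (0, ℓ′) is Serre_w for the level-one ℓ′-adic ρ′. -/
theorem serreBelow_zero_iff (ℓ' : ℕ) [Fact ℓ'.Prime] : SerreBelow 0 ℓ' ↔
    (∀ (K' : Type) [Field K'] [NumberField K'] (n' : ℕ) (hcpt' : isCompact_glFiniteIntegralLevel n' K'), 0 < n' →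
      ∀ (ι' : PadicAlgCl ℓ' ≃+* ℂ) (ρ' : FramedGaloisRep K' (PadicAlgCl ℓ') n'), ρ'.toGaloisRep.IsIrreducible →
        IsPinnedGeometric ρ' → IsUnramifiedAwayFrom ρ' → IsResiduallyAutomorphic hcpt' ι' ρ') := by
  refine ⟨fun h K' _ _ n' hcpt' hn' ι' ρ' hirr hgeo haway => h K' n' hcpt' hn' ι' ρ' hirr hgeo ?_,
    fun h K' _ _ n' hcpt' hn' ι' ρ' hirr hgeo hlev => h K' n' hcpt' hn' ι' ρ' hirr hgeo ?_⟩
  · exact (hasLevelAtMost_zero_iff ρ').mpr haway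
  · exact (hasLevelAtMost_zero_iff ρ').mp hlev

/-- D's induction hypothesis at height (0, ℓ) IS Z's induction hypothesis at the prime ℓ. -/
theorem ihBelow_zero_iff (ℓ : ℕ) : IHBelow 0 ℓ ↔ LevelOneIH ℓ := by
  constructor
  · intro h ℓ' _ hlt
    exact (serreBelow_zero_iff ℓ').mp (h 0 ℓ' (Or.inr ⟨rfl, hlt⟩))
  · intro h k' ℓ' _ hlt
    rcases hlt with hk | ⟨rfl, hlt⟩
    · exact absurd hk (Nat.not_lt_zero _)
    · exact (serreBelow_zero_iff ℓ').mpr (h ℓ' hlt)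


omit [NumberField K] in
/-- The new dial is the union of g5's first two: ramified away from ℓ ⟺ killable ∨ monodromic. -/
theorem hasRamifiedPlace_iff_killable_or_monodromic (ρ : FramedGaloisRep K (PadicAlgCl ℓ) n) :
    HasRamifiedPlace ρ ↔ HasKillablePlace ρ ∨ IsMonodromic ρ := by
  constructor
  · intro h
    by_cases hk : HasKillablePlace ρ
    · exact Or.inl hk
    · exact Or.inr ⟨h, fun w hw hram hfin => hk ⟨w, hw, hram, hfin⟩⟩
  · rintro (⟨w, hw, hram, -⟩ | ⟨h, -⟩)
    · exact ⟨w, hw, hram⟩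
    · exact h

omit [NumberField K] in
/-- … and the complement of the third: ramified away from ℓ ⟺ ¬ level one. -/
theorem hasRamifiedPlace_iff_not_isUnramifiedAwayFrom (ρ : FramedGaloisRep K (PadicAlgCl ℓ) n) :
    HasRamifiedPlace ρ ↔ ¬ IsUnramifiedAwayFrom ρ := by
  simp only [HasRamifiedPlace, IsUnramifiedAwayFrom, not_forall, exists_prop]

omit [NumberField K] in
/-- (g4) Not lift-minimal = non-minimal at some w (classical logic). -/
theorem not_isLiftMinimal_iff (ρ : FramedGaloisRep K (PadicAlgCl ℓ) n) :
    ¬ IsLiftMinimal ρ ↔ ∃ w, IsNonMinimalAt ρ w := by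
  simp only [IsLiftMinimal, IsNonMinimalAt, not_forall, not_not, exists_prop]

omit [NumberField K] in
/-- A ramified place lies in every level set: a ρ with a ramified place away from ℓ has level ≥ 1. -/
theorem one_le_of_hasLevelAtMost_of_hasRamifiedPlace (ρ : FramedGaloisRep K (PadicAlgCl ℓ) n) {k : ℕ}
    (hlev : HasLevelAtMost ρ k) (hram : HasRamifiedPlace ρ) : 1 ≤ k := by
  obtain ⟨w, hwℓ, hramw⟩ := hram
  obtain ⟨S, hS, hSunr⟩ := hlev
  have hw : w ∈ S := Classical.by_contradiction fun h => hramw (hSunr w h hwℓ)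
  exact le_trans (Finset.card_pos.mpr ⟨w, hw⟩) hS

/-! ## DISSOLUTION OF U: on instance sets K = F ∪ U; as pieces K ⟸ F ∧ U (pure logic) and F ∧ U ⟸ K ∧ L -/

/-- K's instance set from g5's two. -/
theorem ramifiedMinimalBelow_of_killable_monodromic {k ℓ : ℕ} [Fact ℓ.Prime] (hF : KillableBelow k ℓ)
    (hU : MonodromicBelow k ℓ) : RamifiedMinimalBelow k ℓ := by
  intro K _ _ n hcpt hn ι ρ hirr hgeo hcrys hlev hmin hram
  rcases (hasRamifiedPlace_iff_killable_or_monodromic ρ).mp hram with hkill | hmono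
  · exact hF K n hcpt hn ι ρ hirr hgeo hcrys hlev hmin hkill
  · exact hU K n hcpt hn ι ρ hirr hgeo hcrys hlev hmin hmono

/-- g5's F-instance set from K's. -/
theorem killableBelow_of_ramifiedMinimal {k ℓ : ℕ} [Fact ℓ.Prime] (hK : RamifiedMinimalBelow k ℓ) : KillableBelow k ℓ :=
  fun K _ _ n hcpt hn ι ρ hirr hgeo hcrys hlev hmin hkill =>
    hK K n hcpt hn ι ρ hirr hgeo hcrys hlev hmin ((hasRamifiedPlace_iff_killable_or_monodromic ρ).mpr (Or.inl hkill))

/-- g5's U-instance set from K's. -/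
theorem monodromicBelow_of_ramifiedMinimal {k ℓ : ℕ} [Fact ℓ.Prime] (hK : RamifiedMinimalBelow k ℓ) :
    MonodromicBelow k ℓ :=
  fun K _ _ n hcpt hn ι ρ hirr hgeo hcrys hlev hmin hmono =>
    hK K n hcpt hn ι ρ hirr hgeo hcrys hlev hmin ((hasRamifiedPlace_iff_killable_or_monodromic ρ).mpr (Or.inr hmono))

/-- K ⟸ F ∧ U (the level-move hypothesis is not even used). -/
theorem residualInertiaDescent_of_F_U (hF : FiniteInertiaDescent) (hU : MonodromicDescent) : ResidualInertiaDescent :=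
  fun hW hL k ℓ _ h02 hIH _ =>
    ramifiedMinimalBelow_of_killable_monodromic (hF hW hL k ℓ h02 hIH) (hU hW hL k ℓ h02 hIH)

/-- F ⟸ K ∧ L: the sibling L supplies K's level-move hypothesis at the same height. -/
theorem finiteInertiaDescent_of_K_L (hK : ResidualInertiaDescent) (hLM : MinimalLevelDescent.LevelMove) :
    FiniteInertiaDescent :=
  fun hW hL k ℓ _ h02 hIH => killableBelow_of_ramifiedMinimal (hK hW hL k ℓ h02 hIH (hLM hW hL k ℓ h02 hIH))

/-- **U DISSOLVED**: U ⟸ K ∧ L — the lineage's declared residual of record (g5) follows from the attackable K and the sibling L. -/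
theorem monodromicDescent_of_K_L (hK : ResidualInertiaDescent) (hLM : MinimalLevelDescent.LevelMove) :
    MonodromicDescent :=
  fun hW hL k ℓ _ h02 hIH => monodromicBelow_of_ramifiedMinimal (hK hW hL k ℓ h02 hIH (hLM hW hL k ℓ h02 hIH))

/-- Modulo L, K ⟺ F ∧ U. -/
theorem residualInertiaDescent_iff_F_U (hLM : MinimalLevelDescent.LevelMove) :
    ResidualInertiaDescent ↔ FiniteInertiaDescent ∧ MonodromicDescent :=
  ⟨fun hK => ⟨finiteInertiaDescent_of_K_L hK hLM, monodromicDescent_of_K_L hK hLM⟩,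
    fun h => residualInertiaDescent_of_F_U h.1 h.2⟩

/-! ## EXACTNESS: M ⟺ K ∧ Z modulo L;  D ⟺ W ∧ L ∧ K ∧ Z modulo NOTHING -/

/-- M's instance set at (k, ℓ) from K's, L's and Z's (dichotomy ramified-away-from-ℓ / level one; on the level-one class the
height frame is discharged: k = 0 uses Z, k ≥ 1 uses D's induction hypothesis at the smaller height (0, ℓ)). -/
theorem minimalBelow_of_pieces {k ℓ : ℕ} [Fact ℓ.Prime] (h02 : ¬ (k = 0 ∧ ℓ = 2)) (hIH : IHBelow k ℓ)
    (hK : RamifiedMinimalBelow k ℓ) (hZ : ℓ ≠ 2 → LevelOneIH ℓ → LevelOneBelow ℓ) : MinimalBelow k ℓ := by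
  intro K _ _ n hcpt hn ι ρ hirr hgeo hcrys hlev hmin
  by_cases hram : HasRamifiedPlace ρ
  · exact hK K n hcpt hn ι ρ hirr hgeo hcrys hlev hmin hram
  · have haway : IsUnramifiedAwayFrom ρ :=
      Classical.by_contradiction fun h => hram ((hasRamifiedPlace_iff_not_isUnramifiedAwayFrom ρ).mpr h)
    rcases Nat.eq_zero_or_pos k with rfl | hk
    · have hℓ : ℓ ≠ 2 := fun h => h02 ⟨rfl, h⟩
      exact hZ hℓ ((ihBelow_zero_iff ℓ).mp hIH) K n hcpt hn ι ρ hirr hgeo hcrys haway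
    · exact hIH 0 ℓ (Or.inl hk) K n hcpt hn ι ρ hirr hgeo ((hasLevelAtMost_zero_iff ρ).mpr haway)

/-- M ⟸ K ∧ Z ∧ L, proved. -/
theorem minimalCrystallineDescent_of_pieces (hK : ResidualInertiaDescent) (hZ : LevelOneCrystallineDescent)
    (hLM : MinimalLevelDescent.LevelMove) : MinimalCrystallineDescent₀ :=
  fun hW hL k ℓ _ h02 hIH =>
    minimalBelow_of_pieces h02 hIH (hK hW hL k ℓ h02 hIH (hLM hW hL k ℓ h02 hIH)) (hZ hW hL ℓ)

/-- M ⟹ K (restriction: discard the ramified-place and level-move hypotheses). -/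
theorem residualInertiaDescent_of_minimal (hM : MinimalCrystallineDescent₀) : ResidualInertiaDescent :=
  fun hW hL k ℓ _ h02 hIH _ K _ _ n hcpt hn ι ρ hirr hgeo hcrys hlev hmin _ =>
    hM hW hL k ℓ h02 hIH K n hcpt hn ι ρ hirr hgeo hcrys hlev hmin

/-- M ⟹ Z (M at height (0, ℓ): level one is level ≤ 0 and is vacuously lift-minimal; Z's IH is D's IH at (0, ℓ)). [g5] -/
theorem levelOneCrystallineDescent_of_minimal (hM : MinimalCrystallineDescent₀) :
    LevelOneCrystallineDescent :=
  fun hW hL ℓ _ hℓ hIH K _ _ n hcpt hn ι ρ hirr hgeo hcrys haway =>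
    hM hW hL 0 ℓ (fun h => hℓ h.2) ((ihBelow_zero_iff ℓ).mpr hIH) K n hcpt hn ι ρ hirr hgeo hcrys
      ((hasLevelAtMost_zero_iff ρ).mpr haway) (isLiftMinimal_of_isUnramifiedAwayFrom ρ haway)

/-- EXACT modulo the sibling L: M ⟺ K ∧ Z. -/
theorem minimalCrystallineDescent_iff_pieces (hLM : MinimalLevelDescent.LevelMove) :
    MinimalCrystallineDescent₀ ↔ ResidualInertiaDescent ∧ LevelOneCrystallineDescent :=
  ⟨fun hM => ⟨residualInertiaDescent_of_minimal hM, levelOneCrystallineDescent_of_minimal hM⟩,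
    fun h => minimalCrystallineDescent_of_pieces h.1 h.2 hLM⟩

/-- THE FOUR-PIECE GLUE W → L → K → Z → D (= the tree's gen-2 glue item `MinimalLevelDescent.LevelPrimeDescent_of_resplit`,
stmt-Langlands-31278, whose children W 31274, L 31275, K 31276, Z 31277 are byte-identical to the decls used here), proved DIRECTLY (g6's
`resplit_glue.lean`, no longer through the retired M / the orphaned gen-1 glue): W reduces to the crystalline case; excluded middle on
lift-minimality (L takes the non-minimal class); a lift-minimal ρ is ramified away from ℓ (K, fed with L's conclusion at the same height)
or has level one — k = 0 is Z (its IH is D's IH at (0, ℓ′)), k ≥ 1 is D's own IH at (0, ℓ). -/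
theorem levelPrimeDescent_of_four (hWM : MinimalLevelDescent.WeightMove) (hLM : MinimalLevelDescent.LevelMove)
    (hK : ResidualInertiaDescent) (hZ : LevelOneCrystallineDescent) : MinimalLevelDescent.LevelPrimeDescent := by
  intro hW hL k ℓ _ h02 hIH
  refine hWM hW hL k ℓ h02 hIH ?_
  intro K _ _ n hcpt hn ι ρ hirr hgeo hcrys hlev
  have hN := hLM hW hL k ℓ h02 hIH
  by_cases hmin : ∀ w : IsDedekindDomain.HeightOneSpectrum (NumberField.RingOfIntegers K),
      ((ℓ : ℕ) : NumberField.RingOfIntegers K) ∉ w.asIdeal → ¬ ρ.IsUnramifiedAt w →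
        ∀ τ : Field.absoluteGaloisGroup K →* Matrix.GeneralLinearGroup (Fin n)
            (Literature.NumberTheory.GaloisRepresentations.padicAlgClResidueField ℓ),
          ρ.IsResidualRepOf
              (RingHom.id (Literature.NumberTheory.GaloisRepresentations.padicAlgClResidueField ℓ)) τ →
            ¬ (∀ 𝔓 ∈ w.primesAbove, ∀ σ ∈ 𝔓.inertia (Field.absoluteGaloisGroup K), τ σ = 1)
  · by_cases hram : ∃ w : IsDedekindDomain.HeightOneSpectrum (NumberField.RingOfIntegers K),
        ((ℓ : ℕ) : NumberField.RingOfIntegers K) ∉ w.asIdeal ∧ ¬ ρ.IsUnramifiedAt w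
    · exact hK hW hL k ℓ h02 hIH hN K n hcpt hn ι ρ hirr hgeo hcrys hlev hmin hram
    · have haway : ∀ w : IsDedekindDomain.HeightOneSpectrum (NumberField.RingOfIntegers K),
          ((ℓ : ℕ) : NumberField.RingOfIntegers K) ∉ w.asIdeal → ρ.IsUnramifiedAt w :=
        fun w hw => Classical.by_contradiction fun hr => hram ⟨w, hw, hr⟩
      rcases Nat.eq_zero_or_pos k with rfl | hk
      · refine hZ hW hL ℓ (fun h => h02 ⟨rfl, h⟩) ?_ K n hcpt hn ι ρ hirr hgeo hcrys haway
        intro ℓ' _ hlt K' _ _ n' hcpt' hn' ι' ρ' hirr' hgeo' haway'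
        exact hIH 0 ℓ' (Or.inr ⟨rfl, hlt⟩) K' n' hcpt' hn' ι' ρ' hirr' hgeo' ⟨∅, by simp, fun v _ hv => haway' v hv⟩
      · exact hIH 0 ℓ (Or.inl hk) K n hcpt hn ι ρ hirr hgeo ⟨∅, by simp, fun v _ hv => haway v hv⟩
  · push Not at hmin
    obtain ⟨w, hwℓ, hram, τ, hτ, htriv⟩ := hmin
    exact hN K n hcpt hn ι ρ hirr hgeo hcrys hlev ⟨w, hwℓ, hram, τ, hτ, htriv⟩

/-- The resplit glue W → L → K → Z → D holds (= `levelPrimeDescent_of_four`). [pure logic] -/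
theorem fourGlue_holds : FourGlue := levelPrimeDescent_of_four

/-- D ⟹ W (restriction). [g4, over the tree decl] -/
theorem weightMove_of_descent (hD : MinimalLevelDescent.LevelPrimeDescent) : MinimalLevelDescent.WeightMove :=
  fun hW hL k ℓ _ h02 hIH _ => hD hW hL k ℓ h02 hIH

/-- D ⟹ L (restriction). [g4, over the tree decl] -/
theorem levelMove_of_descent (hD : MinimalLevelDescent.LevelPrimeDescent) : MinimalLevelDescent.LevelMove :=
  fun hW hL k ℓ _ h02 hIH K _ _ n hcpt hn ι ρ hirr hgeo _ hlev _ => hD hW hL k ℓ h02 hIH K n hcpt hn ι ρ hirr hgeo hlev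

/-- D ⟹ M (restriction). [g4] -/
theorem minimal_of_descent (hD : MinimalLevelDescent.LevelPrimeDescent) : MinimalCrystallineDescent₀ :=
  fun hW hL k ℓ _ h02 hIH K _ _ n hcpt hn ι ρ hirr hgeo _ hlev _ => hD hW hL k ℓ h02 hIH K n hcpt hn ι ρ hirr hgeo hlev

/-- **EXACT SPLIT OF D, modulo NOTHING: D ⟺ W ∧ L ∧ K ∧ Z.** -/
theorem levelPrimeDescent_iff_four : MinimalLevelDescent.LevelPrimeDescent ↔
    MinimalLevelDescent.WeightMove ∧ MinimalLevelDescent.LevelMove ∧ ResidualInertiaDescent ∧ LevelOneCrystallineDescent :=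
  ⟨fun hD => ⟨weightMove_of_descent hD, levelMove_of_descent hD, residualInertiaDescent_of_minimal (minimal_of_descent hD),
      levelOneCrystallineDescent_of_minimal (minimal_of_descent hD)⟩,
    fun h => levelPrimeDescent_of_four h.1 h.2.1 h.2.2.1 h.2.2.2⟩

/-- M ⟹ F (restriction). [g5] -/
theorem finiteInertiaDescent_of_minimal (hM : MinimalCrystallineDescent₀) : FiniteInertiaDescent :=
  fun hW hL k ℓ _ h02 hIH K _ _ n hcpt hn ι ρ hirr hgeo hcrys hlev hmin _ =>
    hM hW hL k ℓ h02 hIH K n hcpt hn ι ρ hirr hgeo hcrys hlev hmin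

/-- M ⟹ U (restriction). [g5] -/
theorem monodromicDescent_of_minimal (hM : MinimalCrystallineDescent₀) : MonodromicDescent :=
  fun hW hL k ℓ _ h02 hIH K _ _ n hcpt hn ι ρ hirr hgeo hcrys hlev hmin _ =>
    hM hW hL k ℓ h02 hIH K n hcpt hn ι ρ hirr hgeo hcrys hlev hmin

/-- g5's exact split re-derived through the new dial: M ⟺ F ∧ U ∧ Z (nothing of record is lost; U is merely shown non-residual). -/
theorem minimalCrystallineDescent_iff_g5 : MinimalCrystallineDescent₀ ↔
    FiniteInertiaDescent ∧ MonodromicDescent ∧ LevelOneCrystallineDescent :=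
  ⟨fun hM => ⟨finiteInertiaDescent_of_minimal hM, monodromicDescent_of_minimal hM, levelOneCrystallineDescent_of_minimal hM⟩,
    fun h hW hL k ℓ _ h02 hIH => minimalBelow_of_pieces h02 hIH
      (ramifiedMinimalBelow_of_killable_monodromic (h.1 hW hL k ℓ h02 hIH) (h.2.1 hW hL k ℓ h02 hIH)) (h.2.2 hW hL ℓ)⟩

/-- The verbatim-frame restriction and the filed k-free text are EQUIVALENT by pure logic (heights (k, ℓ), k ≥ 1, of a level-one
ρ are discharged by D's IH at (0, ℓ); at k = 0 the two IHs coincide, `ihBelow_zero_iff`). -/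
theorem levelOneSliceFrame_iff : LevelOneSliceFrame ↔ LevelOneCrystallineDescent := by
  constructor
  · intro h hW hL ℓ _ hℓ hIH K _ _ n hcpt hn ι ρ hirr hgeo hcrys haway
    exact h hW hL 0 ℓ (fun h' => hℓ h'.2) ((ihBelow_zero_iff ℓ).mpr hIH) K n hcpt hn ι ρ hirr hgeo hcrys
      ((hasLevelAtMost_zero_iff ρ).mpr haway) (isLiftMinimal_of_isUnramifiedAwayFrom ρ haway) haway
  · intro hZ hW hL k ℓ _ h02 hIH K _ _ n hcpt hn ι ρ hirr hgeo hcrys _ _ haway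
    rcases Nat.eq_zero_or_pos k with rfl | hk
    · exact hZ hW hL ℓ (fun h => h02 ⟨rfl, h⟩) ((ihBelow_zero_iff ℓ).mp hIH) K n hcpt hn ι ρ hirr hgeo hcrys haway
    · exact hIH 0 ℓ (Or.inl hk) K n hcpt hn ι ρ hirr hgeo ((hasLevelAtMost_zero_iff ρ).mpr haway)


/-- SD's inlined text IS the ledger item stmt-Langlands-29341 `SolvableReachSplit.SolvableDescent`. [bookkeeping] -/
theorem solvableDescent_iff_item : SolvableDescent ↔ SolvableReachSplit.SolvableDescent := Iff.rfl

end Summit.Langlands.Langlands.Theorems.LevelOneDyadic
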